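import Summits.Ventures.YMGap.FlowData.TubeTransferPositivity
import Literature.MathematicalPhysics.QuantumFieldTheory.SliceKernelOperatorDerivative
import HarnessLib

/-!
# Venture YMGap, track Y3 FLOW-DATA — `J ↦ log ‖T_{J,k,L}‖` (log of the vacuum eigenvalue of the TUBE
# TRANSFER OPERATOR) is convex on `ℝ`, and for `J > 0` DIFFERENTIABLE with the Hellmann–Feynman derivative,
# enclosed by the secant chords (theorems only; the `hd`/`hF` premises of `SecantConvexCertificate.lean`)

HONEST FRAMING: venture file of the cell `pub-ymgap` (QuantumFields programme), track Y3. It discharges, for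
the tree's named object `tubeTransferOperator ρ J k L` (`TubeTransferOperator.lean`), the two premises that
`SecantConvexCertificate.lean` takes as hypotheses for `F J = log ‖T_{J,k,L}‖`: CONVEXITY of `F` on `ℝ` (Kingman,
tree `convexOn_log_norm_sliceKernelOp_iso`) and DIFFERENTIABILITY of `F` at every `J₀ > 0` (Kato II-§5.4 /
VIII-§2.3 with `m = 1`, tree `exists_hasDerivAt_log_norm_sliceKernelOp_iso`: operator-norm differentiability of
the slice-kernel family + Jentzsch's simple isolated top eigenvalue + Lüscher positivity for `J ≥ 0`), the
derivative being the Hellmann–Feynman value `⟪φ, T′φ⟫/‖T_{J₀}‖` on the Perron–Jentzsch vector `φ`.  One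
transfer operator family on a fixed spatial torus `(ℤ/L)^k`; `‖T‖ = λ₀` is the vacuum eigenvalue, not a gap;
nothing about `L → ∞`, the time direction, the continuum, confinement or a mass gap; no number, no row.

* `tubeTransferOperator_hasDerivAt` — `J ↦ T_{J,k,L}` is differentiable IN OPERATOR NORM at every `J₀`
  (derivative = the isotropic derivative-kernel operator);
* `convexOn_log_norm_tubeTransferOperator` — `J ↦ log ‖T_{J,k,L}‖` is convex on `ℝ`;
* ★ `tubeTransferOperator_hasDerivAt_log_norm` — for `J₀ > 0`: `∃ T′ φ`, `HasDerivAt T T′ J₀`, `φ` the unit, a.e.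
  positive top eigenvector of `T_{J₀}`, `HasDerivAt (fun J => log ‖T_J‖) (⟪φ, T′φ⟫/‖T_{J₀}‖) J₀`, and for every
  `h > 0` the backward/forward chord slopes enclose that derivative.

References: T. Kato, *Perturbation Theory for Linear Operators* (1966), II-§5.4 Thm 5.4, VIII-§2.3 Thm 2.6
[Kato1966]; M. Lüscher, Commun. Math. Phys. 54 (1977) 283 [Luscher1977]; M. Reed, B. Simon, *Methods of Modern
Mathematical Physics IV*, Thms XIII.43–44 [ReedSimonIV1978]; J. F. C. Kingman, Quart. J. Math. 12 (1961) 283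
[Kingman1961].
-/

noncomputable section

open MeasureTheory Set Filter Function Topology
open scoped RealInnerProductSpace ENNReal
open Literature.MathematicalPhysics.QuantumFieldTheory Literature.Analysis.OperatorTheory

namespace Summit.Ventures.YMGap.FlowData

section LogNormDerivative

variable {G : Type*} [Group G] [TopologicalSpace G] [IsTopologicalGroup G] [CompactSpace G]
  [MeasurableSpace G] [BorelSpace G] [SecondCountableTopology G] {n : ℕ}
  (ρ : G →* Matrix (Fin n) (Fin n) ℂ) (k L : ℕ) [NeZero L]

/-- **`J ↦ T_{J,k,L}` is differentiable in operator norm** at every `J₀`; the derivative is the bounded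
operator with the isotropic derivative kernel (temporal-plaquette insertion + the magnetic half-weights'
derivative). [cite: Kato1966, II-§5.4 (5.9)–(5.10)] -/
theorem tubeTransferOperator_hasDerivAt (hρ : Continuous ρ) (J₀ : ℝ) :
    ∃ T' : Lp ℝ 2 (sliceMeasure G k L) →L[ℝ] Lp ℝ 2 (sliceMeasure G k L),
      HasDerivAt (fun J => tubeTransferOperator ρ J k L) T' J₀ := by
  obtain ⟨S', hS'⟩ := exists_sliceKernelIsoDerivOp (d := k) (L := L) (μ := sliceMeasure G k L) ρ hρ J₀
  exact ⟨S', hasDerivAt_sliceKernelOp_iso (μ := sliceMeasure G k L) ρ hρ J₀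
    (S := fun J => tubeTransferOperator ρ J k L) (fun J φ => tubeTransferOperator_ae_eq J k L hρ φ) hS'⟩

/-- **`J ↦ log ‖T_{J,k,L}‖` is convex on `ℝ`** (Kingman's log-convexity of the top eigenvalue of an
entrywise log-convex family of positive kernels). [cite: Kingman1961, Theorem] -/
theorem convexOn_log_norm_tubeTransferOperator (hρ : Continuous ρ) :
    ConvexOn ℝ univ (fun J : ℝ => Real.log ‖tubeTransferOperator ρ J k L‖) :=
  convexOn_log_norm_sliceKernelOp_iso (μ := sliceMeasure G k L) ρ hρ
    (IsProbabilityMeasure.ne_zero (sliceMeasure G k L))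
    (S := fun J => tubeTransferOperator ρ J k L) fun J φ => tubeTransferOperator_ae_eq J k L hρ φ

/-- ★ **`log λ₀(T_{J,k,L})` is differentiable for `J₀ > 0`, with the Hellmann–Feynman derivative, enclosed by
the secant chords.** For continuous unitary `ρ` and `J₀ > 0` there are the operator-norm derivative `T′` of
`J ↦ T_{J,k,L}` at `J₀` and a unit, a.e. strictly positive `φ` with `T_{J₀} φ = ‖T_{J₀}‖ φ` such that
`J ↦ log ‖T_{J,k,L}‖` has derivative `⟪φ, T′φ⟫/‖T_{J₀}‖` at `J₀` and, for every `h > 0`,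
`(log‖T_{J₀}‖ − log‖T_{J₀−h}‖)/h ≤ ⟪φ, T′φ⟫/‖T_{J₀}‖ ≤ (log‖T_{J₀+h}‖ − log‖T_{J₀}‖)/h`.  Inputs (all tree
theorems): Lüscher positivity `T_J ⪰ 0` for `J ≥ 0` (`inner_tubeTransferOperator_self_nonneg`), Jentzsch's gap,
Kingman, and the operator-norm differentiability above. [cite: Kato1966, VIII-§2.3 Theorem 2.6 (2.17) (case
m = 1)] [cite: ReedSimonIV1978, Thm XIII.43 and Thm XIII.44] [cite: Luscher1977] -/
theorem tubeTransferOperator_hasDerivAt_log_norm (hρ : Continuous ρ)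
    (hρu : ∀ g, ρ g ∈ Matrix.unitaryGroup (Fin n) ℂ) {J₀ : ℝ} (hJ₀ : 0 < J₀) :
    ∃ (T' : Lp ℝ 2 (sliceMeasure G k L) →L[ℝ] Lp ℝ 2 (sliceMeasure G k L))
      (φ : Lp ℝ 2 (sliceMeasure G k L)),
      HasDerivAt (fun J => tubeTransferOperator ρ J k L) T' J₀ ∧
      ‖φ‖ = 1 ∧ IsStrictlyPositiveFun φ ∧
      tubeTransferOperator ρ J₀ k L φ = ‖tubeTransferOperator ρ J₀ k L‖ • φ ∧
      HasDerivAt (fun J => Real.log ‖tubeTransferOperator ρ J k L‖)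
        (⟪φ, T' φ⟫ / ‖tubeTransferOperator ρ J₀ k L‖) J₀ ∧
      ∀ h : ℝ, 0 < h →
        (Real.log ‖tubeTransferOperator ρ J₀ k L‖ -
            Real.log ‖tubeTransferOperator ρ (J₀ - h) k L‖) / h ≤
          ⟪φ, T' φ⟫ / ‖tubeTransferOperator ρ J₀ k L‖ ∧
        ⟪φ, T' φ⟫ / ‖tubeTransferOperator ρ J₀ k L‖ ≤
          (Real.log ‖tubeTransferOperator ρ (J₀ + h) k L‖ -
            Real.log ‖tubeTransferOperator ρ J₀ k L‖) / h := by
  have hS : ∀ J : ℝ, ∀ φ : Lp ℝ 2 (sliceMeasure G k L),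
      (tubeTransferOperator ρ J k L φ : GaugeConfig k L G → ℝ) =ᵐ[sliceMeasure G k L]
        fun a => ∫ b, sliceKernel ρ J J a b * φ b ∂(sliceMeasure G k L) :=
    fun J φ => tubeTransferOperator_ae_eq J k L hρ φ
  obtain ⟨S', hS'⟩ := exists_sliceKernelIsoDerivOp (d := k) (L := L) (μ := sliceMeasure G k L) ρ hρ J₀
  have hpsd : ∀ᶠ J in 𝓝 J₀, ∀ φ : Lp ℝ 2 (sliceMeasure G k L),
      0 ≤ ⟪φ, tubeTransferOperator ρ J k L φ⟫ := by
    filter_upwards [Ioi_mem_nhds hJ₀] with J hJ φ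
    exact inner_tubeTransferOperator_self_nonneg ρ hρ hρu (le_of_lt hJ) φ
  obtain ⟨φ, hφ1, hφpos, hTφ, hder, hbr⟩ :=
    exists_hasDerivAt_log_norm_sliceKernelOp_iso (μ := sliceMeasure G k L) ρ hρ hρu
      (IsProbabilityMeasure.ne_zero (sliceMeasure G k L)) J₀
      (S := fun J => tubeTransferOperator ρ J k L) hS hS' hpsd
  exact ⟨S', φ, hasDerivAt_sliceKernelOp_iso (μ := sliceMeasure G k L) ρ hρ J₀
    (S := fun J => tubeTransferOperator ρ J k L) hS hS', hφ1, hφpos, hTφ, hder, hbr⟩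

end LogNormDerivative

end Summit.Ventures.YMGap.FlowData

end
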